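import Summits.Ventures.PackingBounds.Configurations.LeechCard4600
import Summits.Ventures.PackingBounds.Configurations.LeechSectionCount

/-!
# Coordinate sections of the Leech minimal vectors, I: codes at `cos θ ≤ 1/3` in dimensions `13`–`20`

Framing: lottery ticket; floor = certified bounds/negative ranges. Venture `PackingBounds` (cell `pub-packcert`,
seat `pub-packcert-sdp`), the ATTAINED side of the B2c cells `(n, 1/3)`, `13 ≤ n ≤ 20` (no attained-side entry so
far; certified upper bounds by three-point SDP / Levenshtein LP are in the cell files).

For a set `J₀` of coordinates (all `≥ 2`) let `S(J₀)` be the set of minimal vectors `y` of the Leech lattice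
(`√8`-scaling, `LeechVectors.lean`) with `y₀ = y₁ = 2` and `y_j = 0` for `j ∈ J₀`. Shapes `A` (entries `0, ±4`) and
`C` (odd entries) are excluded by `y₀ = 2`, so `S(J₀)` consists of the shape-`B` vectors `(±2⁸, 0¹⁶)` on the octads
through `0, 1` avoiding `J₀`, with signs `+, +` at `0, 1`: **`|S(J₀)| = 32 · K(J₀)`**, `K(J₀)` the number of such octads
(a kernel count over the `759` octads, one `decide` per row). Deleting the coordinates `0, 1` (`cut2`) leaves integer
vectors of norm `32 - 8 = 24` with pairwise inner products `y·y' - 8 ≤ 16 - 8 = 8` (`ip_le_of_mem`), i.e. cosines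
`≤ 1/3`, inside the coordinate subspace `{z : z_j = 0, j ∈ {0, 1} ∪ J₀}` of dimension `22 - |J₀|`;
`SubspaceTransfer.exists_transfer_orthogonal` moves them to `ℝⁿ`, `n = 22 - |J₀|` (`exists_code_third_of_octads`,
generic in `J₀`). The sets `J₀` below maximise `K` for each `|J₀|` (exhaustive search over the Golay code, seat file
`work/explore/coordsec.py`; `M₂₄` is transitive on pairs, so fixing `{0, 1}` loses nothing): `K = 40, 28, 20, 16, 16,
10, 7, 4` for `|J₀| = 2, …, 9`, giving **`A(20, arccos 1/3) ≥ 1280`, `A(19, ·) ≥ 896`, `A(18, ·) ≥ 640`,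
`A(17, ·) ≥ 512`, `A(16, ·) ≥ 512`, `A(15, ·) ≥ 320`, `A(14, ·) ≥ 224`, `A(13, ·) ≥ 128`** (for `|J₀| = 1` the same
construction gives `56 · 32 = 1792`, the `(21, 1792, 1/3)` row of `LeechCodesThird.lean`, whose `(22, 2816, 1/3)`
row uses a mixed condition and beats `|J₀| = 0`, `77 · 32 = 2464`). In sphere language (SPLAG Ch. 14 Thm 1) the rows
say: in the coordinate section `{y_j = 0, j ∈ J₀}` of the Leech packing, at least `32 · K(J₀)` spheres touch each of
two touching spheres. For comparison, binary codes (`x ↦ ((-1)^{x_i}/√n)_i`) give `A(n, arccos 1/3) ≥ A₂(n, ⌈n/3⌉)`: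
`64, 128, 256, 256` for `n = 13, …, 16` (`A₂(13,5) = 64`, `A₂(14,5) = 128`, `A₂(15,5) = A₂(16,6) = 256`, the
Nordstrom–Robinson code), below the rows here; SPLAG Table 9.2 (from [Ass1]) lists bounds on `A(n, cos⁻¹ 1/3)` only for `n ≤ 10` and
`n = 23`, and no value in print was found for `11 ≤ n ≤ 22` (presearch: corpus + galaxy, needles "arccos 1/3" /
"touch two spheres").

## References
* J. H. Conway, N. J. A. Sloane, *Sphere Packings, Lattices and Groups*, 3rd ed., Ch. 4 §11 (the minimal vectors
  (135)), Ch. 10 §2 (octads, the Steiner system `S(5, 8, 24)`), Ch. 14 Theorem 1. [`ConwaySloane1999`]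
-/

namespace Summit.Ventures.PackingBounds.Config.Leech.PrefixThird

open Finset Golay Summit.Ventures.PackingBounds.Config.Leech

/-! ### The sections -/

/-- The section `S(J₀)`: minimal vectors with `y₀ = y₁ = 2` vanishing on `J₀`. -/
noncomputable def sec (J0 : Finset (Fin 24)) : Finset (Fin 24 → ℤ) :=
  leechInt.filter fun y => (y 0 = 2 ∧ y 1 = 2) ∧ ∀ j ∈ J0, y j = 0

/-- Members of `S(J₀)`. -/
theorem mem_sec {J0 : Finset (Fin 24)} {y : Fin 24 → ℤ} (hy : y ∈ sec J0) :
    y ∈ leechInt ∧ (y 0 = 2 ∧ y 1 = 2) ∧ ∀ j ∈ J0, y j = 0 := by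
  simpa [sec] using hy

/-! ### Shapes `A` and `C` contribute nothing (`y₀ = 2` is impossible) -/

/-- Entries of a shape-`A` vector are never `2`. -/
theorem avec_apply_ne_two (k l : Fin 24) (a b : Bool) (j : Fin 24) : avec k l a b j ≠ 2 := by
  unfold avec
  rcases sgn_cases a with ha | ha <;> rcases sgn_cases b with hb | hb <;> rw [ha, hb] <;> split_ifs <;> omega

/-- Entries of a shape-`C` vector are never `2`. -/
theorem cvec_apply_ne_two (i : Fin 24) (u : ℕ) (j : Fin 24) : cvec i u j ≠ 2 := by
  rcases cvec_apply_cases i u j with ⟨_, h | h⟩ | ⟨_, h | h⟩ <;> omega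

/-- Shape `A`: no vector satisfies the condition. -/
theorem card_A (J0 : Finset (Fin 24)) :
    (idxA.filter fun p => ((avec p.1.1 p.1.2 p.2.1 p.2.2) 0 = 2 ∧ (avec p.1.1 p.1.2 p.2.1 p.2.2) 1 = 2) ∧
      ∀ j ∈ J0, (avec p.1.1 p.1.2 p.2.1 p.2.2) j = 0).card = 0 := by
  rw [Finset.card_eq_zero, Finset.filter_eq_empty_iff]
  rintro p - ⟨⟨h0, -⟩, -⟩
  exact avec_apply_ne_two _ _ _ _ 0 h0

/-- Shape `C`: no vector satisfies the condition. -/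
theorem card_C (J0 : Finset (Fin 24)) :
    ((univ ×ˢ range 4096).filter fun p : Fin 24 × ℕ =>
      ((cvec p.1 p.2) 0 = 2 ∧ (cvec p.1 p.2) 1 = 2) ∧ ∀ j ∈ J0, (cvec p.1 p.2) j = 0).card = 0 := by
  rw [Finset.card_eq_zero, Finset.filter_eq_empty_iff]
  rintro p - ⟨⟨h0, -⟩, -⟩
  exact cvec_apply_ne_two _ _ 0 h0

/-! ### Shape `B`: octads through `0, 1` avoiding `J₀`, signs `+, +` -/

/-- `y₀ = y₁ = 2` on shape `B`: the octad contains `0, 1` and the first two sign bits are `+`. -/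
theorem bvec_01_iff (o : Fin 759) (v : ℕ) :
    (bvec o v 0 = 2 ∧ bvec o v 1 = 2) ↔
      ((0 : Fin 24) ∈ osupp o ∧ (1 : Fin 24) ∈ osupp o) ∧ (v.testBit 0 = false ∧ v.testBit 1 = false) := by
  rw [← bvec_nbr_iff, ip_x0]
  constructor
  · rintro ⟨h0, h1⟩; omega
  · intro h
    rcases bvec_apply_cases o v 0 with ⟨-, e0⟩ | ⟨-, e0 | e0⟩ <;>
      rcases bvec_apply_cases o v 1 with ⟨-, e1⟩ | ⟨-, e1 | e1⟩ <;> omega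

/-- The condition on shape `B`: the octad contains `0, 1` and avoids `J₀`, first two sign bits `+`. -/
theorem cond_bvec_iff (J0 : Finset (Fin 24)) (o : Fin 759) (v : ℕ) :
    (((bvec o v) 0 = 2 ∧ (bvec o v) 1 = 2) ∧ ∀ j ∈ J0, (bvec o v) j = 0) ↔
      (((0 : Fin 24) ∈ osupp o ∧ (1 : Fin 24) ∈ osupp o) ∧ ∀ j ∈ J0, j ∉ osupp o) ∧
        (v.testBit 0 = false ∧ v.testBit 1 = false) := by
  rw [bvec_01_iff]
  constructor
  · rintro ⟨⟨h01, hv⟩, hJ⟩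
    exact ⟨⟨h01, fun j hj => (bvec_eq_zero_iff o v j).mp (hJ j hj)⟩, hv⟩
  · rintro ⟨⟨h01, hJ⟩, hv⟩
    exact ⟨⟨h01, hv⟩, fun j hj => (bvec_eq_zero_iff o v j).mpr (hJ j hj)⟩

/-- `32 · K` shape-`B` vectors satisfy the condition, `K` the number of admissible octads. -/
theorem card_B (J0 : Finset (Fin 24)) {K : ℕ}
    (hK : (univ.filter fun o : Fin 759 =>
      ((0 : Fin 24) ∈ osupp o ∧ (1 : Fin 24) ∈ osupp o) ∧ ∀ j ∈ J0, j ∉ osupp o).card = K) :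
    ((univ ×ˢ range 128).filter fun p : Fin 759 × ℕ =>
      (((bvec p.1 p.2) 0 = 2 ∧ (bvec p.1 p.2) 1 = 2) ∧ ∀ j ∈ J0, (bvec p.1 p.2) j = 0)).card = 32 * K := by
  rw [Finset.filter_congr (fun p _ => cond_bvec_iff J0 p.1 p.2),
    Finset.filter_product (fun o : Fin 759 => ((0 : Fin 24) ∈ osupp o ∧ (1 : Fin 24) ∈ osupp o) ∧ ∀ j ∈ J0, j ∉ osupp o)
      (fun v : ℕ => v.testBit 0 = false ∧ v.testBit 1 = false),
    card_product, hK, card_patterns_00, mul_comm]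

/-- **`|S(J₀)| = 32 · K(J₀)`.** [cite: ConwaySloane1999, Ch. 4 §11 (135)] -/
theorem card_sec (J0 : Finset (Fin 24)) {K : ℕ}
    (hK : (univ.filter fun o : Fin 759 =>
      ((0 : Fin 24) ∈ osupp o ∧ (1 : Fin 24) ∈ osupp o) ∧ ∀ j ∈ J0, j ∉ osupp o).card = K) :
    (sec J0).card = 32 * K := by
  rw [sec, card_filter_leechInt (fun y => (y 0 = 2 ∧ y 1 = 2) ∧ ∀ j ∈ J0, y j = 0) (card_A J0) (card_B J0 hK)
    (card_C J0)]
  omega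

/-! ### Deleting the coordinates `0, 1` -/

/-- `y` with the coordinates `0, 1` set to `0` (integer, norm `24` on the sections). -/
def cut2 (y : Fin 24 → ℤ) : Fin 24 → ℤ := fun j => if j.val < 2 then 0 else y j

/-- Inner products after the cut. -/
theorem ip_cut2 (y y' : Fin 24 → ℤ) : ip (cut2 y) (cut2 y') = ip y y' - (y 0 * y' 0 + y 1 * y' 1) := by
  simp [ip, cut2, Fin.sum_univ_succ]

/-- `cut2` is injective on each section. -/
theorem cut2_injOn (J0 : Finset (Fin 24)) : Set.InjOn cut2 ↑(sec J0) := by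
  intro y hy y' hy' h
  obtain ⟨_, ⟨a0, a1⟩, -⟩ := mem_sec (Finset.mem_coe.mp hy)
  obtain ⟨_, ⟨b0, b1⟩, -⟩ := mem_sec (Finset.mem_coe.mp hy')
  funext j
  by_cases hj : j.val < 2
  · have : j = 0 ∨ j = 1 := by
      rcases Nat.lt_or_ge j.val 1 with h | h
      · exact Or.inl (Fin.ext (by simp; omega))
      · exact Or.inr (Fin.ext (by simp; omega))
    rcases this with rfl | rfl <;> omega
  · have := congrFun h j
    simpa [cut2, hj] using this

/-- The cut, normalised section (in `ℝ²⁴`). -/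
noncomputable def pre (J0 : Finset (Fin 24)) : Finset (EuclideanSpace ℝ (Fin 24)) :=
  (sec J0).image fun y => toE 24 (cut2 y)

/-- `|pre J₀| = |S(J₀)|`. -/
theorem card_pre (J0 : Finset (Fin 24)) : (pre J0).card = (sec J0).card := by
  rw [pre, card_image_of_injOn]
  intro y hy y' hy' h
  exact cut2_injOn J0 hy hy' (toE_injective (by norm_num) h)

/-- The cut vectors are unit vectors after scaling by `1/√24`. -/
theorem norm_pre (J0 : Finset (Fin 24)) : ∀ x ∈ pre J0, ‖x‖ = 1 := by
  intro x hx
  obtain ⟨y, hy, rfl⟩ := mem_image.mp hx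
  obtain ⟨hL, ⟨h0, h1⟩, -⟩ := mem_sec hy
  refine norm_toE (by norm_num) ?_
  rw [ip_cut2, ip_self_of_mem hL, h0, h1]; norm_num

/-- Distinct cut vectors have inner product `≤ 1/3`. -/
theorem inner_pre (J0 : Finset (Fin 24)) : ∀ x ∈ pre J0, ∀ x' ∈ pre J0, x ≠ x' → inner ℝ x x' ≤ 1 / 3 := by
  intro x hx x' hx' hne
  obtain ⟨y, hy, rfl⟩ := mem_image.mp hx
  obtain ⟨y', hy', rfl⟩ := mem_image.mp hx'
  obtain ⟨hL, ⟨h0, h1⟩, -⟩ := mem_sec hy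
  obtain ⟨hL', ⟨h0', h1'⟩, -⟩ := mem_sec hy'
  have hyy : y ≠ y' := fun h => hne (by rw [h])
  rw [inner_toE (by norm_num), ip_cut2, h0, h1, h0', h1', div_le_iff₀ (by norm_num)]
  have h16 : (ip y y' : ℝ) ≤ 16 := by exact_mod_cast ip_le_of_mem hL hL' hyy
  push_cast
  linarith

/-! ### Coordinate normals and the transfer to `ℝⁿ` -/

/-- The coordinate vector `e_j` (integer coordinates). -/
def e (j : Fin 24) : Fin 24 → ℤ := fun i => if i = j then 1 else 0

/-- Testing against `e_j` reads off the coordinate. -/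
theorem ip_e (j : Fin 24) (y : Fin 24 → ℤ) : ip (e j) y = y j := by
  simp [ip, e]

/-- The vanishing set `{0, 1} ∪ J₀` of the cut vectors. -/
def zset (J0 : Finset (Fin 24)) : Finset (Fin 24) := (univ.filter fun j : Fin 24 => j.val < 2) ∪ J0

/-- The cut vectors vanish on `zset J₀`. -/
theorem cut2_apply_eq_zero {J0 : Finset (Fin 24)} {y : Fin 24 → ℤ} (hy : y ∈ sec J0) {j : Fin 24}
    (hj : j ∈ zset J0) : cut2 y j = 0 := by
  obtain ⟨_, -, hJ⟩ := mem_sec hy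
  rcases Finset.mem_union.mp hj with h | h
  · have h' := (Finset.mem_filter.mp h).2
    simp [cut2, h']
  · by_cases h' : j.val < 2
    · simp [cut2, h']
    · simp [cut2, h', hJ j h]

/-- The coordinate normals indexed by `zset J₀` (via its increasing enumeration), scaled. -/
noncomputable def normals (J0 : Finset (Fin 24)) {k : ℕ} (hk : (zset J0).card = k) :
    Fin k → EuclideanSpace ℝ (Fin 24) := fun i => toE 24 (e ((zset J0).orderEmbOfFin hk i))

/-- The normals are pairwise orthogonal and nonzero, hence linearly independent. -/
theorem linearIndependent_normals (J0 : Finset (Fin 24)) {k : ℕ} (hk : (zset J0).card = k) :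
    LinearIndependent ℝ (normals J0 hk) := by
  apply linearIndependent_of_ne_zero_of_inner_eq_zero
  · intro i h0
    have hi := inner_toE (q := 24) (by norm_num) (e ((zset J0).orderEmbOfFin hk i)) (e ((zset J0).orderEmbOfFin hk i))
    rw [normals] at h0
    rw [h0, inner_zero_left, ip_e] at hi
    simp [e] at hi
  · intro i j hij
    rw [normals, normals, inner_toE (by norm_num), ip_e]
    have hne : (zset J0).orderEmbOfFin hk i ≠ (zset J0).orderEmbOfFin hk j :=
      fun h => hij (((zset J0).orderEmbOfFin hk).injective h)
    simp [e, hne]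

/-- The cut vectors are orthogonal to the normals. -/
theorem orth_pre (J0 : Finset (Fin 24)) {k : ℕ} (hk : (zset J0).card = k) :
    ∀ x ∈ pre J0, ∀ i, inner ℝ (normals J0 hk i) x = 0 := by
  intro x hx i
  obtain ⟨y, hy, rfl⟩ := mem_image.mp hx
  rw [normals, inner_toE (by norm_num), ip_e, cut2_apply_eq_zero hy ((zset J0).orderEmbOfFin_mem hk i)]
  simp

/-- **Generic row.** If `K` octads contain `0, 1` and avoid `J₀`, and `n + |{0,1} ∪ J₀| = 24`, then there are
`32 · K` unit vectors in `ℝⁿ` with pairwise inner products `≤ 1/3`. [cite: ConwaySloane1999, Ch. 4 §11 (135)] -/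
theorem exists_code_third_of_octads (J0 : Finset (Fin 24)) {K k n : ℕ}
    (hK : (univ.filter fun o : Fin 759 =>
      ((0 : Fin 24) ∈ osupp o ∧ (1 : Fin 24) ∈ osupp o) ∧ ∀ j ∈ J0, j ∉ osupp o).card = K)
    (hk : (zset J0).card = k) (hn : n + k = 24) :
    ∃ C : Finset (EuclideanSpace ℝ (Fin n)),
      C.card = 32 * K ∧ (∀ x ∈ C, ‖x‖ = 1) ∧ (∀ x ∈ C, ∀ y ∈ C, x ≠ y → inner ℝ x y ≤ 1 / 3) := by
  obtain ⟨C', hc, hn', hi, _⟩ := exists_transfer_orthogonal (m := 24) (n := n) (k := k) (by omega) _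
    (linearIndependent_normals J0 hk) (pre J0) (orth_pre J0 hk)
  refine ⟨C', by rw [hc, card_pre, card_sec J0 hK], fun x' hx' => ?_, fun x' hx' y' hy' hne => ?_⟩
  · obtain ⟨x, hx, he⟩ := hn' x' hx'
    rw [he]; exact norm_pre J0 x hx
  · obtain ⟨x, hx, y, hy, hxy, he⟩ := hi x' hx' y' hy' hne
    rw [he]; exact inner_pre J0 x hx y hy hxy

/-! ### The rows `n = 20, …, 13` (optimal `J₀` for each size; one kernel octad count each) -/

set_option maxRecDepth 100000 in
set_option maxHeartbeats 1000000 in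
/-- **`A(20, arccos 1/3) ≥ 1280`**: `J₀ = {2, 3}`, `K = 77 - 2·21 + 5 = 40`. [cite: ConwaySloane1999, Ch. 4 §11 (135)] -/
theorem exists_code_dim20_third_1280 : ∃ C : Finset (EuclideanSpace ℝ (Fin 20)),
    C.card = 1280 ∧ (∀ x ∈ C, ‖x‖ = 1) ∧ (∀ x ∈ C, ∀ y ∈ C, x ≠ y → inner ℝ x y ≤ 1 / 3) :=
  exists_code_third_of_octads {2, 3} (K := 40) (by decide +kernel) (k := 4) (by decide +kernel) rfl

set_option maxRecDepth 100000 in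
set_option maxHeartbeats 1000000 in
/-- **`A(19, arccos 1/3) ≥ 896`**: `J₀ = {2, 3, 4}`, `K = 77 - 63 + 15 - 1 = 28`. [cite: ConwaySloane1999, Ch. 4 §11 (135)] -/
theorem exists_code_dim19_third_896 : ∃ C : Finset (EuclideanSpace ℝ (Fin 19)),
    C.card = 896 ∧ (∀ x ∈ C, ‖x‖ = 1) ∧ (∀ x ∈ C, ∀ y ∈ C, x ≠ y → inner ℝ x y ≤ 1 / 3) :=
  exists_code_third_of_octads {2, 3, 4} (K := 28) (by decide +kernel) (k := 5) (by decide +kernel) rfl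


set_option maxRecDepth 100000 in
set_option maxHeartbeats 1000000 in
/-- **`A(18, arccos 1/3) ≥ 640`**: `J₀ = {2, 3, 4, 13}` (with `0, 1`: six points of the octad
`{0,1,2,3,4,13,15,20}`), `K = 20`. [cite: ConwaySloane1999, Ch. 4 §11 (135)] -/
theorem exists_code_dim18_third_640 : ∃ C : Finset (EuclideanSpace ℝ (Fin 18)),
    C.card = 640 ∧ (∀ x ∈ C, ‖x‖ = 1) ∧ (∀ x ∈ C, ∀ y ∈ C, x ≠ y → inner ℝ x y ≤ 1 / 3) :=
  exists_code_third_of_octads {2, 3, 4, 13} (K := 20) (by decide +kernel) (k := 6) (by decide +kernel) rfl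

set_option maxRecDepth 100000 in
set_option maxHeartbeats 1000000 in
/-- **`A(17, arccos 1/3) ≥ 512`**: `J₀ = {2, 3, 4, 13, 15}`, `K = 16`. [cite: ConwaySloane1999, Ch. 4 §11 (135)] -/
theorem exists_code_dim17_third_512 : ∃ C : Finset (EuclideanSpace ℝ (Fin 17)),
    C.card = 512 ∧ (∀ x ∈ C, ‖x‖ = 1) ∧ (∀ x ∈ C, ∀ y ∈ C, x ≠ y → inner ℝ x y ≤ 1 / 3) :=
  exists_code_third_of_octads {2, 3, 4, 13, 15} (K := 16) (by decide +kernel) (k := 7) (by decide +kernel) rfl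

set_option maxRecDepth 100000 in
set_option maxHeartbeats 1000000 in
/-- **`A(16, arccos 1/3) ≥ 512`**: `J₀ = {2, 3, 4, 13, 15, 20}` (the octads meeting `{0,1,2,3,4,13,15,20}` exactly
in `{0, 1}`), `K = 16`. [cite: ConwaySloane1999, Ch. 4 §11 (135)] -/
theorem exists_code_dim16_third_512 : ∃ C : Finset (EuclideanSpace ℝ (Fin 16)),
    C.card = 512 ∧ (∀ x ∈ C, ‖x‖ = 1) ∧ (∀ x ∈ C, ∀ y ∈ C, x ≠ y → inner ℝ x y ≤ 1 / 3) :=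
  exists_code_third_of_octads {2, 3, 4, 13, 15, 20} (K := 16) (by decide +kernel) (k := 8) (by decide +kernel) rfl

set_option maxRecDepth 100000 in
set_option maxHeartbeats 1000000 in
/-- **`A(15, arccos 1/3) ≥ 320`**: `J₀ = {2, 3, 4, 5, 6, 8, 18}`, `K = 10`. [cite: ConwaySloane1999, Ch. 4 §11 (135)] -/
theorem exists_code_dim15_third_320 : ∃ C : Finset (EuclideanSpace ℝ (Fin 15)),
    C.card = 320 ∧ (∀ x ∈ C, ‖x‖ = 1) ∧ (∀ x ∈ C, ∀ y ∈ C, x ≠ y → inner ℝ x y ≤ 1 / 3) :=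
  exists_code_third_of_octads {2, 3, 4, 5, 6, 8, 18} (K := 10) (by decide +kernel) (k := 9) (by decide +kernel) rfl

set_option maxRecDepth 100000 in
set_option maxHeartbeats 1000000 in
/-- **`A(14, arccos 1/3) ≥ 224`**: `J₀ = {2, 3, 4, 5, 6, 11, 20, 23}`, `K = 7`. [cite: ConwaySloane1999, Ch. 4 §11 (135)] -/
theorem exists_code_dim14_third_224 : ∃ C : Finset (EuclideanSpace ℝ (Fin 14)),
    C.card = 224 ∧ (∀ x ∈ C, ‖x‖ = 1) ∧ (∀ x ∈ C, ∀ y ∈ C, x ≠ y → inner ℝ x y ≤ 1 / 3) :=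
  exists_code_third_of_octads {2, 3, 4, 5, 6, 11, 20, 23} (K := 7) (by decide +kernel) (k := 10)
    (by decide +kernel) rfl

set_option maxRecDepth 100000 in
set_option maxHeartbeats 1000000 in
/-- **`A(13, arccos 1/3) ≥ 128`**: `J₀ = {2, 3, 4, 5, 6, 7, 8, 11, 17}`, `K = 4`. [cite: ConwaySloane1999, Ch. 4 §11 (135)] -/
theorem exists_code_dim13_third_128 : ∃ C : Finset (EuclideanSpace ℝ (Fin 13)),
    C.card = 128 ∧ (∀ x ∈ C, ‖x‖ = 1) ∧ (∀ x ∈ C, ∀ y ∈ C, x ≠ y → inner ℝ x y ≤ 1 / 3) :=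
  exists_code_third_of_octads {2, 3, 4, 5, 6, 7, 8, 11, 17} (K := 4) (by decide +kernel) (k := 11)
    (by decide +kernel) rfl

end Summit.Ventures.PackingBounds.Config.Leech.PrefixThird
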